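import Mathlib
import Summits.QuantumFields.YangMills.Theorems.TransportFieldKernelDerivative
import Literature.MathematicalPhysics.QuantumFieldTheory.Balaban1983to89.B10Eq18SigmaSU2Haar
import HarnessLib

/-!
# Transport-field regularity kit, tranche 2: the vacuum along RIGHT shifts `U ↦ U[e ↦ U_e·exp(it a·σ)]` — the form in which the
# transport-field / covariant-current stubs are typed

Continuation of `TransportFieldKernelDerivative` (tranche 1: Feynman–Hellmann along exponential LEFT shifts).  The registered stubs
`stub_linearSplit` ⟨23354⟩, `stub_cauchySchwarzCommutator` ⟨23379⟩, `stub_robertsonB` ⟨23380⟩ and the items ⟨23381⟩ `CurrentStatePhysical`,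
⟨23355⟩ `RobertsonInequality` all quantify over `deriv (t ↦ ψ (Function.update U e (U e * expPauli (t • a)))) 0` with Print's chart
`expPauli A = exp(iΣ A^aσ_a)` (tree `B10Eq18SigmaSU2Haar.expPauli`).  This tranche supplies:
* `expPauli_smul_add`, `su2Rep_expPauli_smul` — `t ↦ expPauli (t • a)` is a one-parameter group with `su2Rep`-image `exp(t·su2Coord a)`;
* `update_mul_expPauli_eq_conj_shift`, `conjFamily_mul`, `su2Rep_conjFamily` — the RIGHT shift by `expPauli (t • a)` is the LEFT shift by
  the conjugate family `U_e expPauli(t•a) U_e⁻¹`, whose generator is `Ad(U_e)(su2Coord a) = U_e (su2Coord a) U_e⁻¹`;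
* `hasDerivAt_wilsonAction_shift_explicit` — the tree's action derivative with its Leibniz sum EXPOSED (needed because the generator now
  depends on `U`);
* ★ `hasDerivAt_vacuum_rightShift`, `deriv_vacuum_rightShift` — the vacuum `Ω = λ₀⁻¹K_βΩ` is differentiable along every right `expPauli`
  shift, with the explicit Feynman–Hellmann derivative; in particular the `deriv … 0` in the stubs IS this integral (not Lean's default `0`).
Joint continuity / linearity in the direction `a` (⇒ measurability, boundedness and additivity of `XΩ`) is tranche 3.
HONEST FRAMING: fixed-lattice calculus; no claim about the cruxes, K2a or the YM mass gap.  No `sorry`, no new axiom, no new definition.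
References: [cite: Creutz2022, Ch. 11]; [cite: Balaban1985UV3, p. 260]; [cite: ReedSimonIV1978, Thm. XIII.43].
-/

set_option autoImplicit false

noncomputable section

open MeasureTheory Filter Topology NormedSpace
open scoped BigOperators Matrix.Norms.Frobenius
open Literature.MathematicalPhysics.QuantumFieldTheory (GaugeConfig Site Edge Plaquette wilsonAction plaquetteHolonomy)
open Literature.MathematicalPhysics.QuantumLattice (secondCountableTopology_su2)
open Literature.MathematicalPhysics.QuantumFieldTheory.Balaban1983to89.B10Eq18SigmaSU2 (su2Coord)
open Literature.MathematicalPhysics.QuantumFieldTheory.Balaban1983to89.B10Eq18SigmaSU2Haar (expPauli coe_expPauli)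
open Summit.QuantumFields.YangMills.Cruxes.CurvatureAmnesia.WardDefect.SchwingerDyson
  (shift_zero hasDerivAt_reTrace hasDerivAt_rho_holonomy continuous_leibniz)

namespace Summit.QuantumFields.YangMills.Theorems.TransportField

open Summit.QuantumFields.YangMills.Theorems.FemtoTransferGap

variable {L : ℕ} [NeZero L]

/-! ## §1 Print's chart along a ray is a one-parameter group -/

/-- Print's coordinates are real-homogeneous: `su2Coord (t • x) = t · su2Coord x` (complex scalar). [cite: Balaban1985UV3, p. 260] -/
theorem su2Coord_real_smul (t : ℝ) (x : Fin 3 → ℝ) : su2Coord (t • x) = (t : ℂ) • su2Coord x := by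
  ext i j
  fin_cases i <;> fin_cases j <;> simp [su2Coord, Complex.ofReal_mul] <;> ring

/-- The matrix of `expPauli (t • a)` is `exp(t·su2Coord a)`. [cite: Balaban1985UV3, p. 260] -/
theorem coe_expPauli_smul (a : EuclideanSpace ℝ (Fin 3)) (t : ℝ) :
    ((expPauli (t • a) : SU2) : Matrix (Fin 2) (Fin 2) ℂ) = exp ((t : ℂ) • su2Coord a) := by
  rw [coe_expPauli, WithLp.ofLp_smul, su2Coord_real_smul]

/-- **`expPauli ((s+t)•a) = expPauli (s•a) · expPauli (t•a)`** (commuting exponents; the same statement is proved in the LatticeQCDFlow venture as `Summit.Ventures.LatticeQCDFlow.Exactness.expPauli_add_smul`, not importable here without its HMC stack). [cite: Balaban1985UV3, p. 260] -/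
theorem expPauli_smul_add (a : EuclideanSpace ℝ (Fin 3)) (s t : ℝ) :
    expPauli ((s + t) • a) = expPauli (s • a) * expPauli (t • a) := by
  apply Subtype.ext
  change ((expPauli ((s + t) • a) : SU2) : Matrix (Fin 2) (Fin 2) ℂ) =
    ((expPauli (s • a) : SU2) : Matrix (Fin 2) (Fin 2) ℂ) * ((expPauli (t • a) : SU2) : Matrix (Fin 2) (Fin 2) ℂ)
  rw [coe_expPauli_smul, coe_expPauli_smul, coe_expPauli_smul, Complex.ofReal_add, add_smul]
  exact exp_add_of_commute (((Commute.refl (su2Coord a)).smul_left _).smul_right _)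

/-- `su2Rep (expPauli (t•a)) = exp(t·su2Coord a)`. [cite: Balaban1985UV3, p. 260] -/
theorem su2Rep_expPauli_smul (a : EuclideanSpace ℝ (Fin 3)) (t : ℝ) :
    su2Rep (expPauli (t • a)) = exp ((t : ℂ) • su2Coord a) :=
  coe_expPauli_smul a t

/-! ## §2 A right shift is a conjugated left shift -/

omit [NeZero L] in
/-- `U[e ↦ U_e k] = U[e ↦ (U_e k U_e⁻¹) U_e]`. [folklore] -/
theorem update_mul_eq_conj_update (U : GaugeConfig 3 L SU2) (e : Edge 3 L) (g : SU2) :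
    Function.update U e (U e * g) = Function.update U e (U e * g * (U e)⁻¹ * U e) := by
  rw [inv_mul_cancel_right]

/-- The conjugate family `t ↦ g·expPauli(t•a)·g⁻¹` is multiplicative. [folklore] -/
theorem conjFamily_mul (g : SU2) (a : EuclideanSpace ℝ (Fin 3)) (s t : ℝ) :
    g * expPauli ((s + t) • a) * g⁻¹ = g * expPauli (s • a) * g⁻¹ * (g * expPauli (t • a) * g⁻¹) := by
  rw [expPauli_smul_add]; group

/-- The matrix of `g⁻¹` is the matrix inverse of the matrix of `g` (`g ∈ SU(2)`). [folklore] -/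
theorem su2Rep_inv_eq_matrix_inv (g : SU2) : su2Rep (g⁻¹) = (su2Rep g)⁻¹ := by
  have h1 : (g : Matrix (Fin 2) (Fin 2) ℂ) * star (g : Matrix (Fin 2) (Fin 2) ℂ) = 1 :=
    Matrix.mem_unitaryGroup_iff.mp (Matrix.specialUnitaryGroup_le_unitaryGroup g.2)
  change ((g⁻¹ : SU2) : Matrix (Fin 2) (Fin 2) ℂ) = ((g : SU2) : Matrix (Fin 2) (Fin 2) ℂ)⁻¹
  rw [Matrix.inv_eq_right_inv h1, ← Matrix.star_eq_inv]
  rfl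

/-- `su2Rep (g expPauli(t•a) g⁻¹) = exp(t · Ad(g) su2Coord a)` with `Ad(g)X = gXg⁻¹`. [folklore] -/
theorem su2Rep_conjFamily (g : SU2) (a : EuclideanSpace ℝ (Fin 3)) (t : ℝ) :
    su2Rep (g * expPauli (t • a) * g⁻¹) = exp ((t : ℂ) • (su2Rep g * su2Coord a * (su2Rep g)⁻¹)) := by
  have hunit : IsUnit (su2Rep g) := by
    rw [Matrix.isUnit_iff_isUnit_det]
    have : (g : Matrix (Fin 2) (Fin 2) ℂ).det = 1 := (Matrix.mem_specialUnitaryGroup_iff.mp g.2).2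
    change IsUnit ((g : Matrix (Fin 2) (Fin 2) ℂ).det)
    rw [this]; exact isUnit_one
  rw [map_mul, map_mul, su2Rep_expPauli_smul, su2Rep_inv_eq_matrix_inv]
  rw [show (t : ℂ) • (su2Rep g * su2Coord a * (su2Rep g)⁻¹) = su2Rep g * ((t : ℂ) • su2Coord a) * (su2Rep g)⁻¹ by
    rw [Matrix.mul_smul, Matrix.smul_mul]]
  exact (Matrix.exp_conj _ _ hunit).symm

/-! ## §3 The action derivative with its Leibniz sum exposed -/

/-- The tree's `exists_hasDerivAt_wilsonAction_oneLink` with the derivative made explicit: along `U ↦ U[e ↦ k(t)U_e]`,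
`su2Rep (k t) = exp(tX)`, `d/dt|₀ S(T_tU) = Σ_p −Re tr(Leibniz_X(U,p))`. [cite: Creutz2022, Ch. 11] -/
theorem hasDerivAt_wilsonAction_shift_explicit {k : ℝ → SU2} {X : Matrix (Fin 2) (Fin 2) ℂ}
    (hk : ∀ s t, k (s + t) = k s * k t) (hX : ∀ t, su2Rep (k t) = exp ((t : ℂ) • X)) (e : Edge 3 L) (U : GaugeConfig 3 L SU2) :
    HasDerivAt (fun t : ℝ => wilsonAction su2Rep (Function.update U e (k t * U e)))
      (∑ p : Plaquette 3 L,
        -((((if (p.1, p.2.1.1) = e then X * su2Rep (U e) else 0) * su2Rep (U (p.1.shift p.2.1.1, p.2.1.2)) +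
              su2Rep (U (p.1, p.2.1.1)) * (if (p.1.shift p.2.1.1, p.2.1.2) = e then X * su2Rep (U e) else 0)) *
                su2Rep ((U (p.1.shift p.2.1.2, p.2.1.1))⁻¹) +
            su2Rep (U (p.1, p.2.1.1)) * su2Rep (U (p.1.shift p.2.1.1, p.2.1.2)) *
              (if (p.1.shift p.2.1.2, p.2.1.1) = e then su2Rep ((U e)⁻¹) * (-X) else 0)) * su2Rep ((U (p.1, p.2.1.2))⁻¹) +
          su2Rep (U (p.1, p.2.1.1)) * su2Rep (U (p.1.shift p.2.1.1, p.2.1.2)) * su2Rep ((U (p.1.shift p.2.1.2, p.2.1.1))⁻¹) *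
            (if (p.1, p.2.1.2) = e then su2Rep ((U e)⁻¹) * (-X) else 0)).trace.re) 0 := by
  unfold wilsonAction
  refine HasDerivAt.fun_sum fun p _ => ?_
  have h := (hasDerivAt_reTrace (hasDerivAt_rho_holonomy su2Rep hk hX e U p.1 p.2.1.1 p.2.1.2)).const_sub ((2 : ℕ) : ℝ)
  exact h

/-- Continuity in `U` of the explicit action derivative, for a fixed generator `X`. [folklore] -/
theorem continuous_wilsonActionDeriv (X : Matrix (Fin 2) (Fin 2) ℂ) (e : Edge 3 L) :
    Continuous fun U : GaugeConfig 3 L SU2 => ∑ p : Plaquette 3 L,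
        -((((if (p.1, p.2.1.1) = e then X * su2Rep (U e) else 0) * su2Rep (U (p.1.shift p.2.1.1, p.2.1.2)) +
              su2Rep (U (p.1, p.2.1.1)) * (if (p.1.shift p.2.1.1, p.2.1.2) = e then X * su2Rep (U e) else 0)) *
                su2Rep ((U (p.1.shift p.2.1.2, p.2.1.1))⁻¹) +
            su2Rep (U (p.1, p.2.1.1)) * su2Rep (U (p.1.shift p.2.1.1, p.2.1.2)) *
              (if (p.1.shift p.2.1.2, p.2.1.1) = e then su2Rep ((U e)⁻¹) * (-X) else 0)) * su2Rep ((U (p.1, p.2.1.2))⁻¹) +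
          su2Rep (U (p.1, p.2.1.1)) * su2Rep (U (p.1.shift p.2.1.1, p.2.1.2)) * su2Rep ((U (p.1.shift p.2.1.2, p.2.1.1))⁻¹) *
            (if (p.1, p.2.1.2) = e then su2Rep ((U e)⁻¹) * (-X) else 0)).trace.re := by
  refine continuous_finsetSum _ fun p _ => ?_
  exact (Complex.continuous_re.comp (continuous_leibniz su2Rep continuous_su2Rep e p.1 p.2.1.1 p.2.1.2).matrix_trace).neg

/-! ## §4 ★ The vacuum along right `expPauli` shifts -/

/-- ★★ **The vacuum is differentiable along every RIGHT shift `U ↦ U[e ↦ U_e·expPauli(t•a)]`**, with the explicit Feynman–Hellmann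
derivative for the conjugate generator `X = U_e (su2Coord a) U_e⁻¹` (so that `X U_e = U_e su2Coord a`). [cite: ReedSimonIV1978, Thm. XIII.43]
[cite: Creutz2022, Ch. 11] -/
theorem hasDerivAt_vacuum_rightShift (β : ℝ) (e : Edge 3 L) (a : EuclideanSpace ℝ (Fin 3)) {Ω : GaugeConfig 3 L SU2 → ℝ}
    (hΩ : IsPhys Ω) (heig : transferApply β Ω = topValue su2Rep L β • Ω) (U : GaugeConfig 3 L SU2) :
    let X : Matrix (Fin 2) (Fin 2) ℂ := su2Rep (U e) * su2Coord a * (su2Rep (U e))⁻¹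
    HasDerivAt (fun t : ℝ => Ω (Function.update U e (U e * expPauli (t • a))))
      ((topValue su2Rep L β)⁻¹ *
        ∫ V, transferKernel su2Rep β U V * (β * (X * su2Rep (U e) * su2Rep ((V e)⁻¹)).trace.re - β / 2 *
          ∑ p : Plaquette 3 L,
            -((((if (p.1, p.2.1.1) = e then X * su2Rep (U e) else 0) * su2Rep (U (p.1.shift p.2.1.1, p.2.1.2)) +
                  su2Rep (U (p.1, p.2.1.1)) * (if (p.1.shift p.2.1.1, p.2.1.2) = e then X * su2Rep (U e) else 0)) *
                    su2Rep ((U (p.1.shift p.2.1.2, p.2.1.1))⁻¹) +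
                su2Rep (U (p.1, p.2.1.1)) * su2Rep (U (p.1.shift p.2.1.1, p.2.1.2)) *
                  (if (p.1.shift p.2.1.2, p.2.1.1) = e then su2Rep ((U e)⁻¹) * (-X) else 0)) * su2Rep ((U (p.1, p.2.1.2))⁻¹) +
              su2Rep (U (p.1, p.2.1.1)) * su2Rep (U (p.1.shift p.2.1.1, p.2.1.2)) * su2Rep ((U (p.1.shift p.2.1.2, p.2.1.1))⁻¹) *
                (if (p.1, p.2.1.2) = e then su2Rep ((U e)⁻¹) * (-X) else 0)).trace.re) * Ω V ∂(configMeasure SU2 L)) 0 := by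
  intro X
  -- the conjugate left family
  set g : SU2 := U e with hg
  set k : ℝ → SU2 := fun t => g * expPauli (t • a) * g⁻¹ with hk_def
  have hk : ∀ s t, k (s + t) = k s * k t := fun s t => conjFamily_mul g a s t
  have hX : ∀ t, su2Rep (k t) = exp ((t : ℂ) • X) := fun t => su2Rep_conjFamily g a t
  have hS' := fun W : GaugeConfig 3 L SU2 => hasDerivAt_wilsonAction_shift_explicit hk hX e W
  have h := hasDerivAt_vacuum_shift hk hX β e hΩ heig (continuous_wilsonActionDeriv X e) hS' U
  refine h.congr_of_eventuallyEq (Eventually.of_forall fun t => ?_)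
  show Ω (Function.update U e (U e * expPauli (t • a))) = Ω (Function.update U e (k t * U e))
  rw [hk_def, hg]
  dsimp only
  rw [inv_mul_cancel_right]

/-- ★ **The `deriv` in the stubs is the Feynman–Hellmann integral** (not Lean's default `0`): `deriv (t ↦ Ω(U[e ↦ U_e expPauli(t•a)])) 0`
equals the derivative of `hasDerivAt_vacuum_rightShift`. [cite: ReedSimonIV1978, Thm. XIII.43] -/
theorem deriv_vacuum_rightShift (β : ℝ) (e : Edge 3 L) (a : EuclideanSpace ℝ (Fin 3)) {Ω : GaugeConfig 3 L SU2 → ℝ}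
    (hΩ : IsPhys Ω) (heig : transferApply β Ω = topValue su2Rep L β • Ω) (U : GaugeConfig 3 L SU2) :
    let X : Matrix (Fin 2) (Fin 2) ℂ := su2Rep (U e) * su2Coord a * (su2Rep (U e))⁻¹
    deriv (fun t : ℝ => Ω (Function.update U e (U e * expPauli (t • a)))) 0 =
      (topValue su2Rep L β)⁻¹ *
        ∫ V, transferKernel su2Rep β U V * (β * (X * su2Rep (U e) * su2Rep ((V e)⁻¹)).trace.re - β / 2 *
          ∑ p : Plaquette 3 L,
            -((((if (p.1, p.2.1.1) = e then X * su2Rep (U e) else 0) * su2Rep (U (p.1.shift p.2.1.1, p.2.1.2)) +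
                  su2Rep (U (p.1, p.2.1.1)) * (if (p.1.shift p.2.1.1, p.2.1.2) = e then X * su2Rep (U e) else 0)) *
                    su2Rep ((U (p.1.shift p.2.1.2, p.2.1.1))⁻¹) +
                su2Rep (U (p.1, p.2.1.1)) * su2Rep (U (p.1.shift p.2.1.1, p.2.1.2)) *
                  (if (p.1.shift p.2.1.2, p.2.1.1) = e then su2Rep ((U e)⁻¹) * (-X) else 0)) * su2Rep ((U (p.1, p.2.1.2))⁻¹) +
              su2Rep (U (p.1, p.2.1.1)) * su2Rep (U (p.1.shift p.2.1.1, p.2.1.2)) * su2Rep ((U (p.1.shift p.2.1.2, p.2.1.1))⁻¹) *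
                (if (p.1, p.2.1.2) = e then su2Rep ((U e)⁻¹) * (-X) else 0)).trace.re) * Ω V ∂(configMeasure SU2 L) :=
  (hasDerivAt_vacuum_rightShift β e a hΩ heig U).deriv

/-- ★ **Differentiability along right `expPauli` shifts** (the qualitative statement). [cite: ReedSimonIV1978, Thm. XIII.43] -/
theorem differentiableAt_vacuum_rightShift (β : ℝ) (e : Edge 3 L) (a : EuclideanSpace ℝ (Fin 3)) {Ω : GaugeConfig 3 L SU2 → ℝ}
    (hΩ : IsPhys Ω) (heig : transferApply β Ω = topValue su2Rep L β • Ω) (U : GaugeConfig 3 L SU2) :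
    DifferentiableAt ℝ (fun t : ℝ => Ω (Function.update U e (U e * expPauli (t • a)))) 0 :=
  (hasDerivAt_vacuum_rightShift β e a hΩ heig U).differentiableAt

end Summit.QuantumFields.YangMills.Theorems.TransportField

end
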